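/-
Copyright (c) 2026 the pub-hodgecm-mathlib formalisation cell (harness21).  Prover seat hodgecm-mathlib-K2E3-p06 (g4), Track B «K2-LIT», engine E3, unit U4 «Keys»; deal (D61)
LINE LEAD of the open leaf (U4f-χ₁-ram-one), design D-I v2, plan step Z2 (generic) «THE `(B, θ)`-EIGEN-SECTIONS OVER TWO CELLS FORM A PLANE OF DIMENSION ≤ 2»; 2026-09-04.
KERNEL module: THEOREMS ONLY (no definition, no named fact, no `sorry`, no instance, no notation).
-/
import Summits.HodgeConjecture.HodgeConjecture.Theorems.K2E3TypeVectorSupport     -- ★ Z2-gen p858198 (this seat): `toFun_mul_eq_of_eigen`; brings ★ V2 `apply_eq_mul_one`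
import HarnessLib

/-!
# K2 ∕ E3 «EllipticInputs», unit U4 «Keys» — (U4f-χ₁-ram-one-d0B) step Z2 (generic): A `(B, θ)`-EIGEN-SECTION OF `Ind_H^G τ` IS DETERMINED BY ITS VALUES AT THE CELL REPRESENTATIVES
# «`G = H·B ∪ H·g₀·B` ⟹ `f` is determined by `(f(1), f(g₀))`; the type plane has dimension ≤ 2»   [Roche1998 §3–§4; Casselman1995 §3.3, §6.3; BernsteinZelevinsky1976 §2.3]

Cell hodgecm-mathlib (D-0151), FLOOR 0, Track B «K2-LIT», engine E3, crux item H413 = stmt-HodgeConjecture-24833 (route `HCCMUnconditional`, no route verbs); target BY NAME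
the OPEN leaf `…K2E3EllipticInputs.U4Keys.sig_K2E3KeysThmTwoContractingRamifiedCharOne` (U4Keys ED. 7), Branch B at depth zero (cand v5 leaf (U4f-χ₁-ram-one-d0B)), generic part.
Author K2E3-p06 (g4), line lead (D61).  `--supports stmt-HodgeConjecture-24833 --as helper`; THEOREMS ONLY.  NOT THE PAYER.

THE POINT.  Branch B of design D-I works on the `(I, χ̃)`-type plane of `i(χ)`: the `(B, θ)`-eigen-sections (`B = I`, `θ = χ̃`).  Over the two Bruhat–Iwahori cells
`G = P·I ⊔ P·w₀·I` (★ `cover_borelU_inf`) such a section is explicit on each cell — `f(h b) = τ(h)θ(b)f(1)` (★ Z2-gen `toFun_mul_eq_of_eigen`) and `f(h g₀ b) = τ(h)θ(b)f(g₀)` (§1) —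
hence DETERMINED BY THE PAIR `(f(1), f(g₀))` (§2): the type plane embeds in `ℂ²`, so it is spanned by the two type vectors `f₁, f_w` of PAPER-Z3 §0 once they exist.  Generic in a
topological group `G`, subgroups `H`, `B`, one-dimensional `τ`, any `g₀`.
* §1 `toFun_mul_mul_eq_of_eigen` (`f(h g₀ b) = τ(h)·θ(b)·f(g₀)`).
* §2 **`eq_of_eigen_of_apply_eq`** (two `(B, θ)`-eigen-sections with the same values at `1` and `g₀` coincide, given the cover `G = H·B ∪ H·g₀·B`),
  `eq_zero_of_eigen_of_apply_eq_zero`.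
HONEST LABEL: HC_CM is proved only modulo the 7 printed citations (2 remaining named inputs: hLiu418 = stmt-HodgeConjecture-24832, h413 = stmt-HodgeConjecture-24833)
until rung 0 closes; count-neutral — this file does NOT pay the leaf; no printed citation is discharged.

## References
* [Roche1998] A. Roche, Ann. Sci. ÉNS (4) 31 (1998), §3–§4 (the Hecke-module of `χ̃`-spherical vectors; support on `J g J`).
* [Casselman1995] W. Casselman, *Introduction to the theory of admissible representations of `p`-adic reductive groups* (1995), §3.3, §6.3.
* [BernsteinZelevinsky1976] I. N. Bernstein, A. V. Zelevinsky, Russian Math. Surveys 31:3 (1976), §2.3.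
-/

set_option autoImplicit false
-- the mandated namespace has the single-problem summit's repeated segment (`HodgeConjecture.HodgeConjecture`)
set_option linter.dupNamespace false

noncomputable section

namespace Summit.HodgeConjecture.HodgeConjecture.Cruxes.H413.K2E3IwahoriPlaneTwoCells

open Summit.HodgeConjecture.HodgeConjecture.Cruxes.H413 Summit.HodgeConjecture.HodgeConjecture.Cruxes.H413.K2E3TypeVectorOfSubrep

variable {G : Type*} [Group G] [TopologicalSpace G] [IsTopologicalGroup G] (H : Subgroup G) (τ : Representation ℂ ↥H ℂ)

/-! ## §1 The value on the second cell -/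

/-- **`f(h g₀ b) = τ(h)·θ(b)·f(g₀)`** for a `(B, θ)`-eigen-section `f`, `h ∈ H`, `b ∈ B` (eigen-property at `g₀`, then the section property). [cite: Roche1998, §3–§4] [cite: Casselman1995, §3.3] -/
theorem toFun_mul_mul_eq_of_eigen (B : Subgroup G) (θ : G → ℂ) (f : Representation.SmoothInd H τ)
    (heig : ∀ b ∈ B, Representation.smoothIndRep H τ b f = θ b • f) (h : G) (hh : h ∈ H) (g₀ b : G) (hb : b ∈ B) :
    f.toFun (h * g₀ * b) = τ (⟨h, hh⟩ : ↥H) 1 * θ b * f.toFun g₀ := by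
  have h1 : f.toFun (h * g₀ * b) = θ b * f.toFun (h * g₀) := by
    have e := congrArg (fun φ : Representation.SmoothInd H τ => φ.toFun (h * g₀)) (heig b hb)
    simp only [Representation.toFun_smoothIndRep_apply, Representation.SmoothInd.toFun_smul, Pi.smul_apply, smul_eq_mul] at e
    exact e
  have h2 := f.toFun_subgroup_mul (⟨h, hh⟩ : ↥H) g₀
  rw [apply_eq_mul_one] at h2
  rw [h1, show ((⟨h, hh⟩ : ↥H) : G) * g₀ = h * g₀ from rfl] at *
  rw [h2, ← mul_assoc, mul_comm (θ b)]

/-! ## §2 Determination by the values at `1` and `g₀` -/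

/-- **Two `(B, θ)`-eigen-sections with the same values at `1` and at `g₀` are EQUAL** when `G = H·B ∪ H·g₀·B` — the `(B, θ)`-type plane of `Ind_H^G τ` embeds in `ℂ²` by
`f ↦ (f(1), f(g₀))`. [cite: Roche1998, §3–§4] [cite: Casselman1995, §6.3] [cite: BernsteinZelevinsky1976, §2.3] -/
theorem eq_of_eigen_of_apply_eq (B : Subgroup G) (θ : G → ℂ) (g₀ : G)
    (hcover : ∀ y : G, (∃ h ∈ H, ∃ b ∈ B, y = h * b) ∨ ∃ h ∈ H, ∃ b ∈ B, y = h * g₀ * b)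
    (f f' : Representation.SmoothInd H τ)
    (heig : ∀ b ∈ B, Representation.smoothIndRep H τ b f = θ b • f) (heig' : ∀ b ∈ B, Representation.smoothIndRep H τ b f' = θ b • f')
    (h1 : f.toFun 1 = f'.toFun 1) (hg : f.toFun g₀ = f'.toFun g₀) : f = f' := by
  refine Representation.SmoothInd.ext (funext fun y => ?_)
  rcases hcover y with ⟨h, hh, b, hb, rfl⟩ | ⟨h, hh, b, hb, rfl⟩
  · rw [K2E3TypeVectorSupport.toFun_mul_eq_of_eigen H τ B θ f heig h hh b hb,
      K2E3TypeVectorSupport.toFun_mul_eq_of_eigen H τ B θ f' heig' h hh b hb, h1]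
  · rw [toFun_mul_mul_eq_of_eigen H τ B θ f heig h hh g₀ b hb, toFun_mul_mul_eq_of_eigen H τ B θ f' heig' h hh g₀ b hb, hg]

/-- A `(B, θ)`-eigen-section vanishing at `1` and at `g₀` is ZERO (when `G = H·B ∪ H·g₀·B`). [cite: Roche1998, §3–§4] [cite: Casselman1995, §6.3] -/
theorem eq_zero_of_eigen_of_apply_eq_zero (B : Subgroup G) (θ : G → ℂ) (g₀ : G)
    (hcover : ∀ y : G, (∃ h ∈ H, ∃ b ∈ B, y = h * b) ∨ ∃ h ∈ H, ∃ b ∈ B, y = h * g₀ * b)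
    (f : Representation.SmoothInd H τ) (heig : ∀ b ∈ B, Representation.smoothIndRep H τ b f = θ b • f)
    (h1 : f.toFun 1 = 0) (hg : f.toFun g₀ = 0) : f = 0 := by
  refine eq_of_eigen_of_apply_eq H τ B θ g₀ hcover f 0 heig (fun b _ => by rw [map_zero, smul_zero]) ?_ ?_
  · rw [h1]; rfl
  · rw [hg]; rfl

end Summit.HodgeConjecture.HodgeConjecture.Cruxes.H413.K2E3IwahoriPlaneTwoCells

end
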